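import Summits.CriticalPhenomena.PercolationContinuityZ3.Theorems.PercNearOneGluingNoHeavyLowerTailSahiOneStepFreeExtension
import HarnessLib

/-!
# One-step scheme: the DECOUPLING IDENTITY for `n` along an arbitrary coordinate

Prover prim-ineq-prove-3 gen 40 (`--supports stmt-CriticalPhenomena-4575`; memo
`run/shared/lean/prim/prim-ineq-prove-3/FINDING-G40-DECOUPLING.md` §0(i), §2).  No definitions, no sorries.

For a coordinate `e` and an event `B` write `B¹ = {ω | insert e ω ∈ B}`, `B⁰ = {ω | ω ∖ {e} ∈ B}` for its two sections, regarded as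
`e`-FREE events of the whole cube (cylinders).  Pointwise `1_B = (1−p_e)·1_{B⁰} + p_e·1_{B¹} + (x_e − p_e)·(1_{B¹} − 1_{B⁰})`, so by
bilinearity of `n = osN` in its second argument the functional splits into the two DECOUPLED pairs `(A, B⁰)`, `(A, B¹)` — same first event
`H`, same cube, the coordinate `e` resampled independently inside `B` — plus a correction.  `osN_ind_ind_decouple_eq` records the
correction in closed form for an ARBITRARY first event `H`:
  `n(H;A,B) = q·n(H;A,B⁰) + p·n(H;A,B¹) + pq·{ (μ(H∩A) − μA)·μ((H¹∖H⁰) ⊓ (B¹∖B⁰)) + (1 − μH)·[μ(H¹∩A¹∩B¹) − μ(H¹∩A¹∩B⁰) − μ(H⁰∩A⁰∩B¹) + μ(H⁰∩A⁰∩B⁰)] }`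
(the four-term brackets written out as signed sums of measures, valid without any monotonicity).  For the threshold slot `H = {N_F ≥ t}`,
`e ∈ F`, increasing `A, B`: `H¹ ∖ H⁰ = ∂_e := {N_{F∖e} = t−1}`, `μ(H∩A) − μA = −μ(A ∩ L)`, `1 − μH = μ(L)`, and the second bracket is
`μ(∂_e ∩ A¹ ∩ P_B) + μ({N_{F∖e} ≥ t} ∩ P_A ∩ P_B)` with `P_X = X¹ ∖ X⁰` (the set where `e` is pivotal), i.e. the correction is
`p_eq_e·[μ(L)·μ(A¹ ∩ P_B ∩ ∂_e) + μ(L)·μ(P_A ∩ P_B ∩ {N_{F∖e} ≥ t}) − μ(A∩L)·μ(P_B ∩ ∂_e)]` (memo §2; the "decoupling step inequality" of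
`…SahiOneStepDecouplingStep` is the statement that this correction may borrow the `B⁰`-term on one of the two sides).  Compare the PIVOT identity
`osN_ind_ind_pivot_eq` (gen 19), which conditions on `x_e` and changes the first event to its sections.
-/

noncomputable section

namespace Summit.CriticalPhenomena.PercolationContinuityZ3.Theorems

namespace SahiOneStep

open MeasureTheory
open Literature.Probability.Percolation (DeterminedBy determinedBy_iff)
open Literature.Probability.LatticeModels (prodBernoulli sahiE3)
open Literature.Probability.Percolation.DecisionTree (ind)
open scoped Classical

variable {ι : Type*} [Fintype ι]

/-! ## Sections of the section cylinders -/

omit [Fintype ι] in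
/-- `(B¹)¹ = B¹`. [folklore] -/
theorem section_insert_section_insert (B : Set (Set ι)) (e : ι) :
    {ω : Set ι | insert e ω ∈ {ω : Set ι | insert e ω ∈ B}} = {ω : Set ι | insert e ω ∈ B} := by
  ext ω; simp only [Set.mem_setOf_eq, Set.insert_eq_of_mem (Set.mem_insert e ω)]

omit [Fintype ι] in
/-- `(B¹)⁰ = B¹`. [folklore] -/
theorem section_sdiff_section_insert (B : Set (Set ι)) (e : ι) :
    {ω : Set ι | ω \ {e} ∈ {ω : Set ι | insert e ω ∈ B}} = {ω : Set ι | insert e ω ∈ B} := by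
  ext ω; simp only [Set.mem_setOf_eq, Set.insert_sdiff_singleton]

omit [Fintype ι] in
/-- `(B⁰)¹ = B⁰`. [folklore] -/
theorem section_insert_section_sdiff (B : Set (Set ι)) (e : ι) :
    {ω : Set ι | insert e ω ∈ {ω : Set ι | ω \ {e} ∈ B}} = {ω : Set ι | ω \ {e} ∈ B} := by
  ext ω
  have : insert e ω \ {e} = ω \ {e} := by
    ext x; simp only [Set.mem_sdiff, Set.mem_insert_iff, Set.mem_singleton_iff]; tauto
  simp only [Set.mem_setOf_eq, this]

omit [Fintype ι] in
/-- `(B⁰)⁰ = B⁰`. [folklore] -/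
theorem section_sdiff_section_sdiff (B : Set (Set ι)) (e : ι) :
    {ω : Set ι | ω \ {e} ∈ {ω : Set ι | ω \ {e} ∈ B}} = {ω : Set ι | ω \ {e} ∈ B} := by
  ext ω; simp only [Set.mem_setOf_eq, sdiff_idem]

/-! ## The decoupling identity -/

/-- **DECOUPLING IDENTITY for `n` along an arbitrary coordinate `e`** (resample `e` inside the second event):
`n(H;A,B) = (1−p)·n(H;A,B⁰) + p·n(H;A,B¹) + p(1−p)·{(μ(H∩A) − μA)·[μ(H¹B¹) − μ(H¹B⁰) − μ(H⁰B¹) + μ(H⁰B⁰)]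
  + (1 − μH)·[μ(H¹A¹B¹) − μ(H¹A¹B⁰) − μ(H⁰A⁰B¹) + μ(H⁰A⁰B⁰)]}`. [this work] -/
theorem osN_ind_ind_decouple_eq (p : ι → unitInterval) (H A B : Set (Set ι)) (e : ι) :
    osN p H (ind A) (ind B) =
      (1 - p e) * osN p H (ind A) (ind {ω : Set ι | ω \ {e} ∈ B})
        + (p e : ℝ) * osN p H (ind A) (ind {ω : Set ι | insert e ω ∈ B})
        + (p e : ℝ) * (1 - p e) *
          (((prodBernoulli p).real (H ∩ A) - (prodBernoulli p).real A) *
              ((prodBernoulli p).real ({ω : Set ι | insert e ω ∈ H} ∩ {ω : Set ι | insert e ω ∈ B})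
                - (prodBernoulli p).real ({ω : Set ι | insert e ω ∈ H} ∩ {ω : Set ι | ω \ {e} ∈ B})
                - (prodBernoulli p).real ({ω : Set ι | ω \ {e} ∈ H} ∩ {ω : Set ι | insert e ω ∈ B})
                + (prodBernoulli p).real ({ω : Set ι | ω \ {e} ∈ H} ∩ {ω : Set ι | ω \ {e} ∈ B}))
            + (1 - (prodBernoulli p).real H) *
              ((prodBernoulli p).real ({ω : Set ι | insert e ω ∈ H} ∩ {ω : Set ι | insert e ω ∈ A} ∩ {ω : Set ι | insert e ω ∈ B})
                - (prodBernoulli p).real ({ω : Set ι | insert e ω ∈ H} ∩ {ω : Set ι | insert e ω ∈ A} ∩ {ω : Set ι | ω \ {e} ∈ B})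
                - (prodBernoulli p).real ({ω : Set ι | ω \ {e} ∈ H} ∩ {ω : Set ι | ω \ {e} ∈ A} ∩ {ω : Set ι | insert e ω ∈ B})
                + (prodBernoulli p).real ({ω : Set ι | ω \ {e} ∈ H} ∩ {ω : Set ι | ω \ {e} ∈ A} ∩ {ω : Set ι | ω \ {e} ∈ B}))) := by
  have eB := real_split p e B
  have eHB : (prodBernoulli p).real (H ∩ B) =
      (p e : ℝ) * (prodBernoulli p).real ({ω : Set ι | insert e ω ∈ H} ∩ {ω : Set ι | insert e ω ∈ B}) +
        (1 - p e) * (prodBernoulli p).real ({ω : Set ι | ω \ {e} ∈ H} ∩ {ω : Set ι | ω \ {e} ∈ B}) := by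
    rw [real_split p e (H ∩ B), section_insert_inter, section_sdiff_inter]
  have eHAB : (prodBernoulli p).real (H ∩ A ∩ B) =
      (p e : ℝ) * (prodBernoulli p).real ({ω : Set ι | insert e ω ∈ H} ∩ {ω : Set ι | insert e ω ∈ A} ∩ {ω : Set ι | insert e ω ∈ B}) +
        (1 - p e) * (prodBernoulli p).real ({ω : Set ι | ω \ {e} ∈ H} ∩ {ω : Set ι | ω \ {e} ∈ A} ∩ {ω : Set ι | ω \ {e} ∈ B}) := by
    rw [real_split p e (H ∩ A ∩ B), section_insert_inter, section_sdiff_inter, section_insert_inter, section_sdiff_inter]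
  have eB0 : (prodBernoulli p).real {ω : Set ι | ω \ {e} ∈ B} =
      (p e : ℝ) * (prodBernoulli p).real {ω : Set ι | ω \ {e} ∈ B} + (1 - p e) * (prodBernoulli p).real {ω : Set ι | ω \ {e} ∈ B} := by ring
  have eHB0 : (prodBernoulli p).real (H ∩ {ω : Set ι | ω \ {e} ∈ B}) =
      (p e : ℝ) * (prodBernoulli p).real ({ω : Set ι | insert e ω ∈ H} ∩ {ω : Set ι | ω \ {e} ∈ B}) +
        (1 - p e) * (prodBernoulli p).real ({ω : Set ι | ω \ {e} ∈ H} ∩ {ω : Set ι | ω \ {e} ∈ B}) := by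
    rw [real_split p e (H ∩ _), section_insert_inter, section_sdiff_inter, section_insert_section_sdiff,
      section_sdiff_section_sdiff]
  have eHAB0 : (prodBernoulli p).real (H ∩ A ∩ {ω : Set ι | ω \ {e} ∈ B}) =
      (p e : ℝ) * (prodBernoulli p).real ({ω : Set ι | insert e ω ∈ H} ∩ {ω : Set ι | insert e ω ∈ A} ∩ {ω : Set ι | ω \ {e} ∈ B}) +
        (1 - p e) * (prodBernoulli p).real ({ω : Set ι | ω \ {e} ∈ H} ∩ {ω : Set ι | ω \ {e} ∈ A} ∩ {ω : Set ι | ω \ {e} ∈ B}) := by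
    rw [real_split p e (H ∩ A ∩ _), section_insert_inter, section_sdiff_inter, section_insert_inter, section_sdiff_inter,
      section_insert_section_sdiff, section_sdiff_section_sdiff]
  have eHB1 : (prodBernoulli p).real (H ∩ {ω : Set ι | insert e ω ∈ B}) =
      (p e : ℝ) * (prodBernoulli p).real ({ω : Set ι | insert e ω ∈ H} ∩ {ω : Set ι | insert e ω ∈ B}) +
        (1 - p e) * (prodBernoulli p).real ({ω : Set ι | ω \ {e} ∈ H} ∩ {ω : Set ι | insert e ω ∈ B}) := by
    rw [real_split p e (H ∩ _), section_insert_inter, section_sdiff_inter, section_insert_section_insert,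
      section_sdiff_section_insert]
  have eHAB1 : (prodBernoulli p).real (H ∩ A ∩ {ω : Set ι | insert e ω ∈ B}) =
      (p e : ℝ) * (prodBernoulli p).real ({ω : Set ι | insert e ω ∈ H} ∩ {ω : Set ι | insert e ω ∈ A} ∩ {ω : Set ι | insert e ω ∈ B}) +
        (1 - p e) * (prodBernoulli p).real ({ω : Set ι | ω \ {e} ∈ H} ∩ {ω : Set ι | ω \ {e} ∈ A} ∩ {ω : Set ι | insert e ω ∈ B}) := by
    rw [real_split p e (H ∩ A ∩ _), section_insert_inter, section_sdiff_inter, section_insert_inter, section_sdiff_inter,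
      section_insert_section_insert, section_sdiff_section_insert]
  rw [osN_ind_ind, osN_ind_ind, osN_ind_ind, eHB, eHAB, eB, eHB0, eHAB0, eHB1, eHAB1]
  ring

end SahiOneStep

end Summit.CriticalPhenomena.PercolationContinuityZ3.Theorems
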